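/-
Copyright (c) 2026 the pub-hodgecm-mathlib formalisation cell (harness21).  Prover seat hodgecm-mathlib-K2E1-p08 (g5), Track B ∕ K2-LIT, h413 =
`stmt-HodgeConjecture-24833`, campaign «EIS-RANK-ONE» [D5] `K2E1KFiniteArchSmoothU2`, Fréchet road, file (D5-a3, core): tensor products of one-variable symbols pulled back to
a product space are symbols with the product envelope (dealer K2E1-plan (g4) 2026-09-04T06:23:41Z, my cut 06:24:54Z).
-/
import Mathlib
import HarnessLib

/-!
# K2·E1 — `K2E1TensorSymbolProduct` ([D5] file (D5-a3), core): PULL-BACKS AND FINITE PRODUCTS OF SYMBOLS — if every `‖Dʲ gᵢ(x)‖ ≤ C·eᵢ(x)` (`j ≤ m`) then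
# `‖Dʲ(∏ᵢ gᵢ)(x)‖ ≤ C'·∏ᵢ eᵢ(x)` (`j ≤ m`), and `‖Dʲ(f ∘ L)(x)‖ ≤ ‖f⁽ʲ⁾(Lx)‖` for a linear form `‖L‖ ≤ 1`

Track B ∕ K2-LIT, crux h413 = `stmt-HodgeConjecture-24833`, route of record `HCCMUnconditional`; cell `hodgecm-mathlib`, squad K2, ENGINE E1, campaign EIS-RANK-ONE, deal [D5]
(the `hφarch` binder of ★ `K2E1EisensteinMinusConstantTermBoundedArchCMTwo` for the spherical flat section of `U(1,1)`).  Prover seat `hodgecm-mathlib-K2E1-p08` (g5).  THEOREMS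
ONLY (no `def`, no `instance`, no notation, no named-fact hypothesis, no `sorry`); lane `--kind proof --supports stmt-HodgeConjecture-24833 --as helper` (count-neutral, closes no
socket).  Pure calculus over Mathlib (a librarian may re-home it under `Literature/Analysis/Calculus`).

WHY.  Along the big-cell line the spherical flat section of `U(1,1)` is, on `mixedSpace L⁺ ≅ ℝ^{[L⁺:ℚ]}`, a constant times the TENSOR PRODUCT over the real places `v` of the
one-variable functions `F_v(s_v) = (1 + c_v s_v²)^{−z}` (★ (D5-a1) `K2E1OnePlusSqPowerSymbol`: `‖F_v⁽ʲ⁾‖ ≤ C_j·|F_v|`).  The archimedean binder `hφarch` wants the FRÉCHET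
derivatives on `mixedSpace L⁺` dominated by the product envelope `∏_v |F_v| = H^{Re z}`.  This file is the generic bookkeeping:
* §1 `norm_iteratedFDeriv_comp_clm_le` — `‖Dʲ(f ∘ L)(x)‖ ≤ ‖L‖ʲ · ‖Dʲf(Lx)‖` for a continuous linear `L : X →L[ℝ] Y` (Mathlib `ContinuousLinearMap.iteratedFDeriv_comp_right` +
  `ContinuousMultilinearMap.norm_compContinuousLinearMap_le`), and the scalar case `‖Dʲ(f ∘ ℓ)(x)‖ ≤ ‖ℓ‖ʲ·‖f⁽ʲ⁾(ℓ x)‖` (`norm_iteratedFDeriv_eq_norm_iteratedDeriv`).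
* §2 **`exists_norm_iteratedFDeriv_finset_prod_le`** — for a finset `s` of smooth `gᵢ : X → 𝔸` (`𝔸` a normed commutative `ℝ`-algebra) with `‖Dʲgᵢ(x)‖ ≤ C·eᵢ(x)` for all
  `j ≤ m`, `x` (`eᵢ ≥ 0`): `∃ C' ≥ 0, ∀ j ≤ m, ∀ x, ‖Dʲ(∏_{i∈s} gᵢ)(x)‖ ≤ C'·∏_{i∈s} eᵢ(x)` (Leibniz ★ Mathlib `norm_iteratedFDeriv_mul_le`, `Σᵢ C(n,i) = 2ⁿ`, induction on `s`),
  with `contDiff_finset_prod'` carried along.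
[Hörmander, ALPDO I, §7.1 (products of symbols); MoeglinWaldspurger1995, I.2.10–I.2.12.]

HONEST LABEL: HC_CM is proved only modulo the 7 printed citations (2 remaining named inputs: hLiu418 = `stmt-HodgeConjecture-24832`, h413 = `stmt-HodgeConjecture-24833`) until
rung 0 closes; count-neutral helper, closes no socket.

## References
* [HormanderALPDO1] L. Hörmander, *The Analysis of Linear Partial Differential Operators I* (1983), §7.1.
* [MoeglinWaldspurger1995] C. Mœglin, J.-L. Waldspurger, *Spectral Decomposition and Eisenstein Series* (1995), I.2.10–I.2.12.
-/

set_option autoImplicit false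
-- the mandated namespace repeats the single-problem summit's segment (`HodgeConjecture.HodgeConjecture`)
set_option linter.dupNamespace false

noncomputable section

open scoped ContDiff

namespace Summit.HodgeConjecture.HodgeConjecture.Cruxes.H413.K2E1TensorSymbolProduct

variable {X Y : Type*} [NormedAddCommGroup X] [NormedSpace ℝ X] [NormedAddCommGroup Y] [NormedSpace ℝ Y]
  {𝔸 : Type*} [NormedCommRing 𝔸] [NormOneClass 𝔸] [NormedAlgebra ℝ 𝔸]

/-! ## §1 Pull-back along a continuous linear map -/

/-- **`‖Dʲ(f ∘ L)(x)‖ ≤ ‖L‖ʲ · ‖Dʲ f(Lx)‖`** for a continuous linear `L` (Mathlib `ContinuousLinearMap.iteratedFDeriv_comp_right`, `norm_compContinuousLinearMap_le`).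
[cite: HormanderALPDO1, §7.1] -/
theorem norm_iteratedFDeriv_comp_clm_le {G : Type*} [NormedAddCommGroup G] [NormedSpace ℝ G] {f : Y → G} {N : WithTop ℕ∞} (hf : ContDiff ℝ N f)
    (L : X →L[ℝ] Y) (x : X) {j : ℕ} (hj : (j : WithTop ℕ∞) ≤ N) :
    ‖iteratedFDeriv ℝ j (f ∘ L) x‖ ≤ ‖L‖ ^ j * ‖iteratedFDeriv ℝ j f (L x)‖ := by
  rw [ContinuousLinearMap.iteratedFDeriv_comp_right L hf x hj]
  refine (ContinuousMultilinearMap.norm_compContinuousLinearMap_le _ _).trans ?_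
  rw [Finset.prod_const, Finset.card_univ, Fintype.card_fin, mul_comm]

/-- **Scalar pull-back**: for `f : ℝ → G` and a continuous linear form `ℓ : X →L[ℝ] ℝ` with `‖ℓ‖ ≤ 1`, `‖Dʲ(f ∘ ℓ)(x)‖ ≤ ‖f⁽ʲ⁾(ℓ x)‖` (`‖Dʲf‖ = ‖f⁽ʲ⁾‖` in one variable).
[cite: HormanderALPDO1, §7.1] -/
theorem norm_iteratedFDeriv_comp_form_le {G : Type*} [NormedAddCommGroup G] [NormedSpace ℝ G] {f : ℝ → G} {N : WithTop ℕ∞} (hf : ContDiff ℝ N f)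
    (ℓ : X →L[ℝ] ℝ) (hℓ : ‖ℓ‖ ≤ 1) (x : X) {j : ℕ} (hj : (j : WithTop ℕ∞) ≤ N) :
    ‖iteratedFDeriv ℝ j (f ∘ ℓ) x‖ ≤ ‖iteratedDeriv j f (ℓ x)‖ := by
  refine (norm_iteratedFDeriv_comp_clm_le hf ℓ x hj).trans ?_
  rw [norm_iteratedFDeriv_eq_norm_iteratedDeriv]
  exact mul_le_of_le_one_left (norm_nonneg _) (pow_le_one₀ (norm_nonneg _) hℓ)

/-! ## §2 Finite products of symbols -/

omit [NormOneClass 𝔸] in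
/-- **TWO FACTORS**: if `f, g : X → 𝔸` are `C^N` with `‖Dʲf(x)‖ ≤ A·e₁(x)` and `‖Dʲg(x)‖ ≤ B·e₂(x)` for all `j ≤ m` (`e₁, e₂ ≥ 0`, `m ≤ N`), then
`‖Dʲ(f·g)(x)‖ ≤ 2ᵐ·A·B·e₁(x)e₂(x)` for all `j ≤ m` (Leibniz, Mathlib `norm_iteratedFDeriv_mul_le`). [cite: HormanderALPDO1, §7.1] -/
theorem norm_iteratedFDeriv_mul_le_of_envelopes {f g : X → 𝔸} {N : WithTop ℕ∞} (hf : ContDiff ℝ N f) (hg : ContDiff ℝ N g) {m : ℕ} (hm : (m : WithTop ℕ∞) ≤ N)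
    {A B : ℝ} {e₁ e₂ : X → ℝ} (hA : 0 ≤ A) (hB : 0 ≤ B) (he₁ : ∀ x, 0 ≤ e₁ x) (he₂ : ∀ x, 0 ≤ e₂ x)
    (hfb : ∀ j ≤ m, ∀ x, ‖iteratedFDeriv ℝ j f x‖ ≤ A * e₁ x) (hgb : ∀ j ≤ m, ∀ x, ‖iteratedFDeriv ℝ j g x‖ ≤ B * e₂ x)
    {j : ℕ} (hj : j ≤ m) (x : X) :
    ‖iteratedFDeriv ℝ j (fun y => f y * g y) x‖ ≤ 2 ^ m * A * B * (e₁ x * e₂ x) := by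
  have hjN : (j : WithTop ℕ∞) ≤ N := le_trans (by exact_mod_cast hj) hm
  -- `Σᵢ C(j, i) = 2ʲ` (reals); cf. ★ `Literature.Geometry.Lorentzian.sum_range_choose_real`
  have hsum : ∑ i ∈ Finset.range (j + 1), ((j.choose i : ℕ) : ℝ) = 2 ^ j := by exact_mod_cast Nat.sum_range_choose j
  refine (norm_iteratedFDeriv_mul_le hf hg x hjN).trans ?_
  calc ∑ i ∈ Finset.range (j + 1), ((j.choose i : ℕ) : ℝ) * ‖iteratedFDeriv ℝ i f x‖ * ‖iteratedFDeriv ℝ (j - i) g x‖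
      ≤ ∑ i ∈ Finset.range (j + 1), ((j.choose i : ℕ) : ℝ) * (A * e₁ x) * (B * e₂ x) := by
        refine Finset.sum_le_sum fun i hi => ?_
        have hij : i ≤ j := Nat.lt_succ_iff.1 (Finset.mem_range.1 hi)
        have h1 := hfb i (hij.trans hj) x
        have h2 := hgb (j - i) ((Nat.sub_le j i).trans hj) x
        have hc : (0 : ℝ) ≤ ((j.choose i : ℕ) : ℝ) := Nat.cast_nonneg _
        calc ((j.choose i : ℕ) : ℝ) * ‖iteratedFDeriv ℝ i f x‖ * ‖iteratedFDeriv ℝ (j - i) g x‖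
            ≤ ((j.choose i : ℕ) : ℝ) * (A * e₁ x) * ‖iteratedFDeriv ℝ (j - i) g x‖ :=
              mul_le_mul_of_nonneg_right (mul_le_mul_of_nonneg_left h1 hc) (norm_nonneg _)
          _ ≤ ((j.choose i : ℕ) : ℝ) * (A * e₁ x) * (B * e₂ x) :=
              mul_le_mul_of_nonneg_left h2 (mul_nonneg hc (mul_nonneg hA (he₁ x)))
    _ = 2 ^ j * A * B * (e₁ x * e₂ x) := by rw [← Finset.sum_mul, ← Finset.sum_mul, hsum]; ring
    _ ≤ 2 ^ m * A * B * (e₁ x * e₂ x) := by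
        have h2 : (2 : ℝ) ^ j ≤ 2 ^ m := pow_le_pow_right₀ (by norm_num) hj
        have hnn : 0 ≤ A * B * (e₁ x * e₂ x) := mul_nonneg (mul_nonneg hA hB) (mul_nonneg (he₁ x) (he₂ x))
        nlinarith

/-- **FINITE PRODUCTS OF SYMBOLS.**  Let `s` be a finset, `gᵢ : X → 𝔸` (`𝔸` a normed commutative `ℝ`-algebra) with `ContDiff ℝ N gᵢ`, envelopes `eᵢ ≥ 0` and one constant `C ≥ 0` with
`‖Dʲ gᵢ(x)‖ ≤ C·eᵢ(x)` for all `i ∈ s`, `j ≤ m` (`m ≤ N`), `x`.  Then the product `∏_{i∈s} gᵢ` is `C^N` and `∃ C' ≥ 0, ∀ j ≤ m, ∀ x, ‖Dʲ(∏_{i∈s} gᵢ)(x)‖ ≤ C'·∏_{i∈s} eᵢ(x)`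
(induction on `s` with §2 `norm_iteratedFDeriv_mul_le_of_envelopes`; `C' = (2ᵐ C)^{#s}` up to the empty product).  With `gᵢ = F_v ∘ ℓ_v` (§1) and ★ (D5-a1) this is the
archimedean symbol estimate for the spherical flat section of `U(1,1)`. [cite: HormanderALPDO1, §7.1] [cite: MoeglinWaldspurger1995, I.2.10–I.2.12] -/
theorem exists_norm_iteratedFDeriv_finset_prod_le {ι : Type*} (s : Finset ι) {g : ι → X → 𝔸} {N : WithTop ℕ∞} (hg : ∀ i ∈ s, ContDiff ℝ N (g i))
    {m : ℕ} (hm : (m : WithTop ℕ∞) ≤ N) {C : ℝ} (hC : 0 ≤ C) {e : ι → X → ℝ} (he : ∀ i ∈ s, ∀ x, 0 ≤ e i x)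
    (hb : ∀ i ∈ s, ∀ j ≤ m, ∀ x, ‖iteratedFDeriv ℝ j (g i) x‖ ≤ C * e i x) :
    ContDiff ℝ N (fun x => ∏ i ∈ s, g i x) ∧
      ∃ C' : ℝ, 0 ≤ C' ∧ ∀ j ≤ m, ∀ x, ‖iteratedFDeriv ℝ j (fun x => ∏ i ∈ s, g i x) x‖ ≤ C' * ∏ i ∈ s, e i x := by
  classical
  induction s using Finset.induction_on with
  | empty =>
    refine ⟨by simpa using contDiff_const, 1, zero_le_one, fun j hj x => ?_⟩
    simp only [Finset.prod_empty, mul_one]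
    -- the constant function `1`
    rcases Nat.eq_zero_or_pos j with rfl | hjpos
    · rw [norm_iteratedFDeriv_zero, norm_one]
    · rw [iteratedFDeriv_const_of_ne (𝕜 := ℝ) hjpos.ne' (1 : 𝔸)]
      simp
  | insert a s ha ih =>
    have hga : ContDiff ℝ N (g a) := hg a (Finset.mem_insert_self a s)
    obtain ⟨hprod, C', hC', hbound⟩ := ih (fun i hi => hg i (Finset.mem_insert_of_mem hi)) (fun i hi => he i (Finset.mem_insert_of_mem hi))
      (fun i hi => hb i (Finset.mem_insert_of_mem hi))
    have hfun : (fun x => ∏ i ∈ insert a s, g i x) = fun x => g a x * ∏ i ∈ s, g i x := by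
      funext x; rw [Finset.prod_insert ha]
    refine ⟨by rw [hfun]; exact hga.mul hprod, 2 ^ m * C * C', by positivity, fun j hj x => ?_⟩
    rw [hfun, Finset.prod_insert ha]
    have h := norm_iteratedFDeriv_mul_le_of_envelopes (e₁ := e a) (e₂ := fun x => ∏ i ∈ s, e i x) hga hprod hm hC hC'
      (he a (Finset.mem_insert_self a s)) (fun x => Finset.prod_nonneg fun i hi => he i (Finset.mem_insert_of_mem hi) x)
      (hb a (Finset.mem_insert_self a s)) hbound hj x
    calc ‖iteratedFDeriv ℝ j (fun y => g a y * ∏ i ∈ s, g i y) x‖ ≤ 2 ^ m * C * C' * (e a x * ∏ i ∈ s, e i x) := h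
      _ = 2 ^ m * C * C' * (e a x * ∏ i ∈ s, e i x) := rfl

end Summit.HodgeConjecture.HodgeConjecture.Cruxes.H413.K2E1TensorSymbolProduct

end
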